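import Mathlib
import Literature.MathematicalPhysics.QuantumFieldTheory.Balaban1983to89.T4EtaRateDefect
import HarnessLib

/-!
# Route «BalabanUVNodes» (K4 «SpineRates»), node N15 = NE2, BACKGROUND LAYER — THE BACKGROUND STEP OF NE2-LOCAL-A: the η-defect
# of the background-dependent propagator `G(U) = Σₙ (G₁V)ⁿG₁` from the η-defect of the `U ≡ 1` propagator `G₁` (NE2⁰), the
# SANDWICHED defect of the perturbation `V`, and letters — `T4EtaRateDefect`'s Neumann bookkeeping with the source term supplied whole

Cell `pub-ymgap`, seat `pub-ymgap-dag-n15-b` (FIRST-MISSING-ESTIMATE, D-0062; `bears_on: R4∕N15`; `--supports stmt-QuantumFields-19351`).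
THEOREMS ONLY; imports `T4EtaRateDefect` (cell `pub-balaban`, lineage pv25: `idef`, `idef_fix`, `idef_comp`, `wnorm`, `hasMaj_wnorm_iff`,
`hasMaj_comp_transfer`, `SlowWeight`) and through it `B9SectDWeightedNeumann.neumann_majorant_wrow`, `B11SectG` BY NAME.

THE PRINT (MECHANISM and SHAPES only; nothing of [B9] asserted).  [Balaban1985BackgroundPropagators] Sect. B, (3.62)–(3.65) pp. 402–403 (verbatim
in the tree header `B9Thm34Ext`): *«the operator V′(A)G′(U) satisfies the bound |(V′(A)G′(U)λ)(x)| ≦ O(1)B₀α₁e^{−δ₀d(y,y′)} (3.63) … I − V′(A)G′(U)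
is an invertible operator, the inverse is given by a convergent Neumann series … G′(U′U) = G′(U)(I − V′(A)G′(U))^{−1} = Σ_{n=0}^∞ G′(U)(V′(A)G′(U))ⁿ.
(3.64) … G′(U′U) = G′(U) + G′(U)V′(A)G′(U′U) (3.65)»* — at `U = 1` in a cube (the record's NE2-LOCAL-A, `pub-balaban/t4/T4-EST-U1a.md` §3
STEP 2: *«in a cube of scale j, gauge to U^u = e^{iηA} with (3.35) p.396, expand (3.50)–(3.53) p.400 … and invert by the Neumann series in
the small first-order perturbation»*): the background-dependent local propagator is the FIXED POINT `X = G₁ + (G₁V)X` of a Neumann ∕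
random-walk equation whose step `G₁V` is small ((3.63)) and whose source is the `U ≡ 1` propagator `G₁`.

WHAT THIS FILE PROVES ([folklore] bookkeeping over hypothesis-shaped data, in the block-majorant currency of `B11SectG`; coarse run unprimed,
fine run primed, transports `τ₁` (sources), `τ₂` (outputs)).  `T4EtaRateDefect.idef_neumann_majorant` takes the step defect `𝔇_K = 𝔇(K′, K)` as a
STANDALONE majorant (slot `hDK`) and composes it with the coarse fixed point inside.  For the background step `K = G₁V` that slot is the wrong
currency: by Leibniz `𝔇(G₁′V′, G₁V)·X = G₁′·𝔇(V′,V)·X + 𝔇(G₁′,G₁)·(VX)`, and the first summand is small ONLY AS A SANDWICH (the derivative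
half of `𝔇(V′,V)` is of order one pointwise and gains its factor `η` from the adjoint-derivative entry of the left factor `G₁′` and the
derivative entry of the right factor `X` — this seat's `BalabanUVNodesN15DerivDefect{,Majorant}` ∕ `…N15FirstOrderDefect`).  Hence:
* §1 `idef_neumann_majorant_of_source` — the Neumann bookkeeping of `T4EtaRateDefect.idef_neumann_majorant` re-run with the WHOLE SOURCE TERM
  `𝔇(S′,S) + 𝔇(K′,K)·A` supplied as ONE source-weighted majorant `c·e^{−ρd}·w(y′)` (no standalone `hDK`): `𝔇(A′,A) ≤ c(1 − κ′m′)⁻¹e^{−ρd}w`.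
* §2 `idef_step_comp_eq` — the exact Leibniz split of the background step's source term,
  `𝔇(G₁′V′, G₁V) ∘ X = G₁′ ∘ 𝔇(V′,V) ∘ X + 𝔇(G₁′,G₁) ∘ (V ∘ X)`.
* §3 **`idef_background_propagator_majorant`** — THE BACKGROUND STEP: if the coarse background propagator solves `X = G₁ + (G₁V)X` and the fine
  one `X′ = G₁′ + (G₁′V′)X′`, the fine step `G₁′V′` has a majorant `N′ ≥ 0` with `‖N′‖_ρ ≤ m′`, `κ′m′ < 1` (SHAPE (3.63): the smallness
  `O(1)B₀α₁`), the coarse `VX` has an exponential majorant `A_V e^{−(ρ+σ)d}` (SHAPE (3.63) for the coarse run), the `U ≡ 1` DEFECT `𝔇(G₁′, G₁)` has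
  a source-weighted majorant `N_G(y,y′)w(y′)` with `‖N_G‖_ρ ≤ m_G` (the node's NE2⁰ LAYER — the -a seat's deliverable, a binder here), the
  SANDWICHED PERTURBATION DEFECT `G₁′ ∘ 𝔇(V′,V) ∘ X` has `c_V·e^{−ρd}w(y′)` (this seat's `hasMaj_comp_idef_firstOrder_comp` ∕ `…_sum_comp`, every
  constant ONE rate factor), and an a priori bound holds (finite lattice), THEN
  `𝔇(X′, X) ≤ (m_G + κm_G A_V C + c_V)·(1 − κ′m′)⁻¹·e^{−ρd(y,y′)}·w(y′)` — the η-defect of `G(U)` in the cube is source-weighted with the SAME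
  weight: NE2⁺-LOCAL ⇐ NE2⁰-LOCAL + (3.35)-shaped coefficient letters + (3.63)-shaped smallness, kernel-checked as bookkeeping.
* §4 `idef_background_propagator_majorant_flat` — the flat-weight reading (`w ≡ 1`, `σ = 0`, `C = 1`).

HONEST FRAMING ∕ LIMITS.  MECHANISM ONLY: every operator and majorant is a binder; (3.63)–(3.65) are SHAPES; the a priori bound is displayed, not
derived; no instance against the actual [B6]∕[B9] operators (S6 of the record NOT attempted); the weight `w` is abstract (for the η-rate weight
`T4EtaRateDefect.rateWeight` its slowness is `slowWeight_rateWeight`).  NE2⁺ NOT PRINTED, NOT proved, class word WORK-bound unchanged; count-neutral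
(typed 28∕28 · discharged 0∕28); one finite T⁴ at fixed ε — NOT infinite volume, NOT OS on ℝ⁴, NOT a mass gap, NOT Clay.
-/

noncomputable section

namespace Summit.QuantumFields.YangMills.BalabanUVNodes.N15.BackgroundStep

open Literature.MathematicalPhysics.QuantumFieldTheory.Balaban1983to89
open Literature.MathematicalPhysics.QuantumFieldTheory.Balaban1983to89.B11SectG (BlockNorm HasMaj hasMaj_comp)
open Literature.MathematicalPhysics.QuantumFieldTheory.Balaban1983to89.T4EtaRateDefect (idef idef_fix idef_comp idef_add wnorm
  hasMaj_wnorm_iff hasMaj_comp_transfer SlowWeight slowWeight_const)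
open Literature.MathematicalPhysics.QuantumFieldTheory.Balaban1983to89.B9SectDWeightedNeumann (WRow neumann_majorant_wrow)
open Literature.MathematicalPhysics.QuantumFieldTheory.Balaban1983to89.B6RandomWalk (Triangle254)

variable {g : B6.Geometry}
variable {F₁ F₂ F₁' F₂' : Type} [AddCommGroup F₁] [Module ℝ F₁] [AddCommGroup F₂] [Module ℝ F₂]
  [AddCommGroup F₁'] [Module ℝ F₁'] [AddCommGroup F₂'] [Module ℝ F₂']

/-! ## §1 The Neumann bookkeeping with the source term supplied whole -/

/-- `T4EtaRateDefect.idef_neumann_majorant` WITH THE SOURCE TERM SUPPLIED WHOLE: coarse `A = S + KA`, fine `A′ = S′ + K′A′` with the fine step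
majorised by `N′ ≥ 0`, `‖N′‖_ρ ≤ m′`, `κ′m′ < 1`; if the source term of the defect's own fixed-point equation (`T4EtaRateDefect.idef_fix`),
`𝔇(S′,S) + 𝔇(K′,K)·A`, has the source-weighted majorant `c·e^{−ρd(y,y′)}·w(y′)` (`w ≥ 0`, `c ≥ 0`) and `𝔇(A′,A)` an a priori bound `M₀·w(y′)`,
then `𝔇(A′,A) ≤ c(1 − κ′m′)⁻¹·e^{−ρd(y,y′)}·w(y′)`. [cite: Balaban1985BackgroundPropagators, (3.64)–(3.65) pp.402–403 (Neumann form, mechanism)] -/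
theorem idef_neumann_majorant_of_source
    {b₁ : BlockNorm g F₁} {b₂' : BlockNorm g F₂'}
    {τ₁ : F₁ →ₗ[ℝ] F₁'} {τ₂ : F₂ →ₗ[ℝ] F₂'}
    {K : Module.End ℝ F₂} {K' : Module.End ℝ F₂'} {S A : F₁ →ₗ[ℝ] F₂} {S' A' : F₁' →ₗ[ℝ] F₂'}
    {N' : g.Site → g.Site → ℝ} {w : g.Site → ℝ} {c m' M₀ ρ : ℝ}
    (htri : Triangle254 g) (hd : ∀ a b : g.Site, 0 ≤ g.dist a b) (hρ : 0 ≤ ρ)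
    (hw : ∀ y, 0 ≤ w y) (hc : 0 ≤ c) (hM₀ : 0 ≤ M₀) (hN' : ∀ x y, 0 ≤ N' x y) (hm' : WRow g ρ N' m')
    (hfix : A = S + K ∘ₗ A) (hfix' : A' = S' + K' ∘ₗ A')
    (hK' : HasMaj b₂' b₂' K' N')
    (hsrc : HasMaj b₁ b₂' (idef τ₁ τ₂ S' S + idef τ₂ τ₂ K' K ∘ₗ A)
      (fun y y' => c * Real.exp (-(ρ * g.dist y y')) * w y'))
    (hap : HasMaj b₁ b₂' (idef τ₁ τ₂ A' A) (fun _ y' => M₀ * w y'))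
    (hq' : b₂'.κ * m' < 1) :
    HasMaj b₁ b₂' (idef τ₁ τ₂ A' A) (fun y y' => c * (1 - b₂'.κ * m')⁻¹ * Real.exp (-(ρ * g.dist y y')) * w y') := by
  intro y₀' μ₀ hμ₀ y₀
  have key : HasMaj (wnorm b₁ w hw) b₂' (idef τ₁ τ₂ A' A)
      (fun y y' => c * (1 - b₂'.κ * m')⁻¹ * Real.exp (-(ρ * g.dist y y'))) :=
    neumann_majorant_wrow (b₁ := wnorm b₁ w hw) htri hd hρ hN' hm' hc hM₀ hK'
      ((hasMaj_wnorm_iff b₁ w hw (K := fun y y' => c * Real.exp (-(ρ * g.dist y y')))).mpr hsrc)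
      (idef_fix τ₁ τ₂ hfix hfix')
      ((hasMaj_wnorm_iff b₁ w hw (K := fun _ _ => M₀)).mpr hap) hq'
  exact (hasMaj_wnorm_iff b₁ w hw).mp key y₀' μ₀ hμ₀ y₀

/-! ## §2 The Leibniz split of the background step's source term -/

/-- EXACT: `𝔇(G₁′V′, G₁V) ∘ X = G₁′ ∘ 𝔇(V′,V) ∘ X + 𝔇(G₁′,G₁) ∘ (V ∘ X)` — the SANDWICHED perturbation defect plus the `U ≡ 1` defect against
the coarse `VX`. [folklore] -/
theorem idef_step_comp_eq (τ₁ : F₁ →ₗ[ℝ] F₁') (τ₂ : F₂ →ₗ[ℝ] F₂') (G₁' : F₁' →ₗ[ℝ] F₂') (V' : F₂' →ₗ[ℝ] F₁')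
    (G₁ : F₁ →ₗ[ℝ] F₂) (V : F₂ →ₗ[ℝ] F₁) (Xc : F₁ →ₗ[ℝ] F₂) :
    idef τ₂ τ₂ (G₁' ∘ₗ V') (G₁ ∘ₗ V) ∘ₗ Xc =
      G₁' ∘ₗ idef τ₂ τ₁ V' V ∘ₗ Xc + idef τ₁ τ₂ G₁' G₁ ∘ₗ (V ∘ₗ Xc) := by
  rw [idef_comp τ₂ τ₁ τ₂ G₁' V' G₁ V]
  ext v
  simp only [LinearMap.comp_apply, LinearMap.add_apply]

/-! ## §3 The background step -/

/-- **THE BACKGROUND STEP OF NE2-LOCAL-A.**  Coarse background propagator `X = G₁ + (G₁V)X` with `VX ≤ A_V e^{−(ρ+σ)d}`; fine `X′ = G₁′ + (G₁′V′)X′`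
with the step majorised by `N′ ≥ 0`, `‖N′‖_ρ ≤ m′`, `κ′m′ < 1` (SHAPE (3.63)); `U ≡ 1` defect `𝔇(G₁′, G₁) ≤ N_G(y,y′)w(y′)`, `N_G ≥ 0`,
`‖N_G‖_ρ ≤ m_G` (the NE2⁰ layer, a binder); SANDWICHED perturbation defect `G₁′ ∘ 𝔇(V′,V) ∘ X ≤ c_V e^{−ρd}w(y′)` (this seat's
`…N15FirstOrderDefect`); slow weight `w ≥ 0` (tilt `σ`, constant `C`); a priori bound `M₀w(y′)`.  THEN
`𝔇(X′, X) ≤ (m_G + κ·m_G·A_V·C + c_V)(1 − κ′m′)⁻¹·e^{−ρd(y,y′)}·w(y′)` (`κ` = the cutting cost of the coarse source space `b₁`).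
[cite: Balaban1985BackgroundPropagators, (3.63)–(3.65) pp.402–403 (mechanism: Neumann series in the small first-order perturbation)] -/
theorem idef_background_propagator_majorant
    {b₁ : BlockNorm g F₁} {b₂' : BlockNorm g F₂'}
    {τ₁ : F₁ →ₗ[ℝ] F₁'} {τ₂ : F₂ →ₗ[ℝ] F₂'}
    {G₁ Xc : F₁ →ₗ[ℝ] F₂} {V : F₂ →ₗ[ℝ] F₁} {G₁' Xf : F₁' →ₗ[ℝ] F₂'} {V' : F₂' →ₗ[ℝ] F₁'}
    {N' N_G : g.Site → g.Site → ℝ} {w : g.Site → ℝ} {m' m_G A_V c_V M₀ ρ σ C : ℝ}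
    (htri : Triangle254 g) (hd : ∀ a b : g.Site, 0 ≤ g.dist a b) (hρ : 0 ≤ ρ)
    (hw : ∀ y, 0 ≤ w y) (hsw : SlowWeight g σ C w) (hC : 0 ≤ C) (hAV : 0 ≤ A_V) (hcV : 0 ≤ c_V) (hM₀ : 0 ≤ M₀)
    (hN' : ∀ x y, 0 ≤ N' x y) (hm' : WRow g ρ N' m') (hNG : ∀ x y, 0 ≤ N_G x y) (hmG : WRow g ρ N_G m_G)
    (hfix : Xc = G₁ + (G₁ ∘ₗ V) ∘ₗ Xc) (hfix' : Xf = G₁' + (G₁' ∘ₗ V') ∘ₗ Xf)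
    (hK' : HasMaj b₂' b₂' (G₁' ∘ₗ V') N')
    (hVX : HasMaj b₁ b₁ (V ∘ₗ Xc) (fun y y' => A_V * Real.exp (-((ρ + σ) * g.dist y y'))))
    (hDG : HasMaj b₁ b₂' (idef τ₁ τ₂ G₁' G₁) (fun y y' => N_G y y' * w y'))
    (hDV : HasMaj b₁ b₂' (G₁' ∘ₗ idef τ₂ τ₁ V' V ∘ₗ Xc) (fun y y' => c_V * Real.exp (-(ρ * g.dist y y')) * w y'))
    (hap : HasMaj b₁ b₂' (idef τ₁ τ₂ Xf Xc) (fun _ y' => M₀ * w y'))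
    (hq' : b₂'.κ * m' < 1) :
    HasMaj b₁ b₂' (idef τ₁ τ₂ Xf Xc)
      (fun y y' => (m_G + b₁.κ * m_G * A_V * C + c_V) * (1 - b₂'.κ * m')⁻¹ * Real.exp (-(ρ * g.dist y y')) * w y') := by
  -- the U ≡ 1 defect on its own: pointwise from the weighted row norm
  have hDS : HasMaj b₁ b₂' (idef τ₁ τ₂ G₁' G₁) (fun y y' => m_G * Real.exp (-(ρ * g.dist y y')) * w y') :=
    hDG.mono fun y y' => mul_le_mul_of_nonneg_right (hmG.pointwise hNG y y') (hw y')
  -- the U ≡ 1 defect against the coarse VX: the located rate loss (the weight's tilt out of VX's rate)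
  have hDGV : HasMaj b₁ b₂' (idef τ₁ τ₂ G₁' G₁ ∘ₗ (V ∘ₗ Xc))
      (fun y y' => b₁.κ * m_G * A_V * C * Real.exp (-(ρ * g.dist y y')) * w y') :=
    hasMaj_comp_transfer htri hρ hAV hC hNG hw hsw hmG hDG hVX
  -- the whole source term of the defect's fixed-point equation
  have hsrc : HasMaj b₁ b₂' (idef τ₁ τ₂ G₁' G₁ + idef τ₂ τ₂ (G₁' ∘ₗ V') (G₁ ∘ₗ V) ∘ₗ Xc)
      (fun y y' => (m_G + b₁.κ * m_G * A_V * C + c_V) * Real.exp (-(ρ * g.dist y y')) * w y') := by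
    rw [idef_step_comp_eq, ← add_assoc]
    refine ((hDS.add hDV).add hDGV).mono fun y y' => le_of_eq ?_
    ring
  intro y₀' μ₀ hμ₀ y₀
  have hmG0 : 0 ≤ m_G := hmG.nonneg hNG y₀
  have hc : 0 ≤ m_G + b₁.κ * m_G * A_V * C + c_V :=
    add_nonneg (add_nonneg hmG0 (mul_nonneg (mul_nonneg (mul_nonneg b₁.κ_nonneg hmG0) hAV) hC)) hcV
  exact idef_neumann_majorant_of_source htri hd hρ hw hc hM₀ hN' hm' hfix hfix' hK' hsrc hap hq' y₀' μ₀ hμ₀ y₀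

/-! ## §4 The flat-weight reading -/

/-- THE FLAT-WEIGHT CASE (`w ≡ 1`, no tilt, no constant): a plain factor (e.g. `θ^k` at the unit scale) carried by `m_G` and `c_V` passes to
`𝔇(X′, X)` with the constant `(m_G(1 + κA_V) + c_V)(1 − κ′m′)⁻¹` at the common rate `ρ`. [folklore] -/
theorem idef_background_propagator_majorant_flat
    {b₁ : BlockNorm g F₁} {b₂' : BlockNorm g F₂'}
    {τ₁ : F₁ →ₗ[ℝ] F₁'} {τ₂ : F₂ →ₗ[ℝ] F₂'}
    {G₁ Xc : F₁ →ₗ[ℝ] F₂} {V : F₂ →ₗ[ℝ] F₁} {G₁' Xf : F₁' →ₗ[ℝ] F₂'} {V' : F₂' →ₗ[ℝ] F₁'}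
    {N' N_G : g.Site → g.Site → ℝ} {m' m_G A_V c_V M₀ ρ : ℝ}
    (htri : Triangle254 g) (hd : ∀ a b : g.Site, 0 ≤ g.dist a b) (hρ : 0 ≤ ρ)
    (hAV : 0 ≤ A_V) (hcV : 0 ≤ c_V) (hM₀ : 0 ≤ M₀)
    (hN' : ∀ x y, 0 ≤ N' x y) (hm' : WRow g ρ N' m') (hNG : ∀ x y, 0 ≤ N_G x y) (hmG : WRow g ρ N_G m_G)
    (hfix : Xc = G₁ + (G₁ ∘ₗ V) ∘ₗ Xc) (hfix' : Xf = G₁' + (G₁' ∘ₗ V') ∘ₗ Xf)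
    (hK' : HasMaj b₂' b₂' (G₁' ∘ₗ V') N')
    (hVX : HasMaj b₁ b₁ (V ∘ₗ Xc) (fun y y' => A_V * Real.exp (-(ρ * g.dist y y'))))
    (hDG : HasMaj b₁ b₂' (idef τ₁ τ₂ G₁' G₁) N_G)
    (hDV : HasMaj b₁ b₂' (G₁' ∘ₗ idef τ₂ τ₁ V' V ∘ₗ Xc) (fun y y' => c_V * Real.exp (-(ρ * g.dist y y'))))
    (hap : HasMaj b₁ b₂' (idef τ₁ τ₂ Xf Xc) (fun _ _ => M₀))
    (hq' : b₂'.κ * m' < 1) :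
    HasMaj b₁ b₂' (idef τ₁ τ₂ Xf Xc)
      (fun y y' => (m_G + b₁.κ * m_G * A_V + c_V) * (1 - b₂'.κ * m')⁻¹ * Real.exp (-(ρ * g.dist y y'))) := by
  have key := idef_background_propagator_majorant (w := fun _ => (1 : ℝ)) (σ := 0) (C := 1) htri hd hρ (fun _ => zero_le_one)
    (slowWeight_const 1) zero_le_one hAV hcV hM₀ hN' hm' hNG hmG hfix hfix' hK' (by simpa only [add_zero] using hVX)
    (by simpa only [mul_one] using hDG) (by simpa only [mul_one] using hDV) (by simpa only [mul_one] using hap) hq'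
  simpa only [mul_one] using key

end Summit.QuantumFields.YangMills.BalabanUVNodes.N15.BackgroundStep
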